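import Summits.ResolutionOfSingularities.ResolutionOfSingularities.Theorems.FrobeniusClosingPatchingRelPerfectDepthPhaseCReachBasic
import Summits.ResolutionOfSingularities.ResolutionOfSingularities.Theorems.FrobeniusClosingPatchingRelPerfectDepthPhaseCLocalGlue
import Summits.ResolutionOfSingularities.ResolutionOfSingularities.Theorems.FrobeniusClosingPatchingRelPerfectDepthHSepComponents
import Literature.AlgebraicGeometry.Resolution.SigmaMaxEliminationInDim
import HarnessLib

/-!
# Crux `PatchingRelPerfect` (stmt-ResolutionOfSingularities-16161), chain W5.2 — F7(β) (β-AX) X3 C-I (A): THE ASSEMBLY SKELETON OF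
# `PhaseCOne CylReach` — two stages (pole cures, then the locally-monomial game) composed with the END GLUE

[OURS · L1 W5.2 · res-L1-w52-plan-1 RULING G12-5 (A) / G12-24 / G12-27 (A) «globalisation of record = (G2)» (hand res-L1-w52-lead-1 g6,
assembly owner).]  Replaces the role of NO printed item; NOT a statement of the manuscript under review (AI-written; AI review weaker than
expert review; counted 0).  Def-free: the two C-I inputs are HYPOTHESES stated over an ABSTRACT «good» predicate on ideal sheaves, so that
the file pins the INTERFACE of the two outstanding hands without depending on their definitions:

* `hLMG` — THE ENGINE (res-D-pv-046, G12-24 (3)/(G2), idea-1 Sketch v18 `X3LemmaM.LocallyMonomialGame` at `Good K := ∃ 𝓛, ∀ x ∈ cosupp K,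
  IsEndNear K 𝓛 x`): on an integral regular excellent Noetherian scheme a non-zero «good» ideal is principalised by blowings up with
  regular centres over its cosupport, regular top (integrality / excellence / `K ≠ 0` are handed over for robustness — res-L1-w52-tri-2
  FIRST-STEP 20:24:35Z — the engine may ignore them);
* `hCure` — THE POLE STAGE (idea-1 (M2b) `ContactCure₂`/`ContactCureReduction` + the member/format letters, res-D-repro-1 AS res-L1-repro-3):
  on a REACHABLE cylinder state which is format-snc on `cyl.V`, finitely many blowings up with regular centres over `cosupp K♭` and regular
  Noetherian top make the TOTAL transform of the residual `K♭` «good».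

PROVED HERE: `CylReach.K_ne_bot` / `CylReach.residual_K_ne_bot` (a reachable state has `K ≠ 0`: its cosupport lies in the members, proper
closed subsets of the integral `X`), the two-stage packaging `exists_centreSeq_two_stage` (no `append`/`eqToHom`: recursion on the first
stage, the transform written along the composite `s.comp ≫ c.comp`), and **`phaseCOne_cylReach_of_stages (Good) (hLMG) (hCure) : PhaseCOne CylReach`** through the END GLUE `phaseCOne_conclusion_of_isEffectiveCartier`
(…DepthPhaseCCarrierCountdown) and `centreSeq_isIntegral_top_and_comap_ne_bot` (…DepthPhaseCLocalGlue: locally principal + integral ⇒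
effective Cartier).

## References
* J. Kollár, *Lectures on Resolution of Singularities* (2007), (3.111) Steps 1–3. [Kollar2007]
* U. Görtz, T. Wedhorn, *Algebraic Geometry I* (2nd ed. 2020), Prop. 13.91 (1)–(2). [GortzWedhorn2020]
-/

-- `Summit.<Summit>.<Sub>.Theorems` with `Sub = Summit` (single-conjunct summit, D-0017)
set_option linter.dupNamespace false

noncomputable section

open CategoryTheory AlgebraicGeometry TopologicalSpace IsLocalRing
open Literature.AlgebraicGeometry.Resolution Scheme.IdealSheafData

namespace Summit.ResolutionOfSingularities.ResolutionOfSingularities.Theorems.ChainW52F7BetaRP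

universe u

open DepthMultiHost

/-! ## §1 A reachable state has a non-zero ideal -/

/-- [OURS · L1 W5.2] **`K ≠ 0` on a reachable cylinder state**: `cosupp K` lies in the union of the members (`CylReach.cosupp_subset_members`),
each an effective Cartier divisor of the integral scheme `X`, so the generic point is off `cosupp K`. [folklore] -/
theorem CylReach.K_ne_bot {X : Scheme.{u}} [IsLocallyNoetherian X] {S : MultiHostState X} {cyl : CylState S} (h : CylReach S cyl) :
    S.K ≠ ⊥ := by
  haveI := h.isIntegral
  intro hK
  have hgen : genericPoint X ∈ (S.K.support : Set X) := by rw [hK, Scheme.IdealSheafData.support_bot]; trivial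
  obtain ⟨T, hT, hxT⟩ := Set.mem_iUnion₂.mp (h.cosupp_subset_members hgen)
  exact not_mem_support_genericPoint (HSepCJS.ne_bot_of_isEffectiveCartier (S.snc.isEffectiveCartier_of_mem hT)) hxT

/-- [OURS · L1 W5.2] **`K♭ ≠ 0`** on a reachable cylinder state (`K ≤ K♭`). [folklore] -/
theorem CylReach.residual_K_ne_bot {X : Scheme.{u}} [IsLocallyNoetherian X] {S : MultiHostState X} {cyl : CylState S}
    (h : CylReach S cyl) : S.residual.K ≠ ⊥ :=
  fun h0 => h.K_ne_bot (le_bot_iff.mp (h0 ▸ S.K_le_residual_K))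

/-! ## §2 Two-stage blow-up sequences -/

/-- [OURS · L1 W5.2] **Two stages make one sequence**: a blow-up sequence `c` of `X` with regular centres over `T`, followed by a blow-up
sequence `s` of its top with regular centres over the preimage of `T`, regular top and `K𝒪` effective Cartier, is ONE blow-up sequence of
`X` with regular centres over `T`, regular top and `K𝒪` effective Cartier (recursion on `c`; the tops agree definitionally). [folklore] -/
theorem exists_centreSeq_two_stage : ∀ {X : Scheme.{u}} (c : CentreSeq X) (K : X.IdealSheafData) (T : Set X),
    c.AllRegular → c.CentresOver T → ∀ (s : CentreSeq c.top), s.AllRegular → s.CentresOver (c.comp.base ⁻¹' T) →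
      Scheme.IsRegular s.top → IsEffectiveCartier (K.comap (s.comp ≫ c.comp)) →
      ∃ t : CentreSeq X, t.AllRegular ∧ t.CentresOver T ∧ Scheme.IsRegular t.top ∧ IsEffectiveCartier (K.comap t.comp)
  | X, .nil _, K, T, _, _, s, hsreg, hsover, hstop, hE => by
    refine ⟨s, hsreg, ?_, hstop, ?_⟩
    · have hT : (CentreSeq.nil X).comp.base ⁻¹' T = T := by ext; rfl
      rwa [hT] at hsover
    · change IsEffectiveCartier (K.comap (s.comp ≫ 𝟙 X)) at hE
      erw [Category.comp_id] at hE
      exact hE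
  | X, .cons C rest, K, T, hcreg, hcover, s, hsreg, hsover, hstop, hE => by
    obtain ⟨hC, hrest⟩ := hcreg
    obtain ⟨hCT, hrestT⟩ := hcover
    have hsover' : s.CentresOver (rest.comp.base ⁻¹' (blowup.π C ⁻¹' T)) := by
      rw [← Set.preimage_comp]; exact hsover
    have hE' : IsEffectiveCartier ((K.comap (blowup.π C)).comap (s.comp ≫ rest.comp)) := by
      change IsEffectiveCartier (K.comap (s.comp ≫ rest.comp ≫ blowup.π C)) at hE
      rwa [← Category.assoc, Scheme.IdealSheafData.comap_comp] at hE
    obtain ⟨t, htreg, htover, httop, htE⟩ :=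
      exists_centreSeq_two_stage rest (K.comap (blowup.π C)) (blowup.π C ⁻¹' T) hrest hrestT s hsreg hsover' hstop hE'
    refine ⟨.cons C t, ⟨hC, htreg⟩, ⟨hCT, htover⟩, httop, ?_⟩
    change IsEffectiveCartier (K.comap (t.comp ≫ blowup.π C))
    rwa [Scheme.IdealSheafData.comap_comp]

/-! ## §3 The assembly -/

/-- [OURS · L1 W5.2 · F7(β) (β-AX) X3 C-I (A)] **`PhaseCOne CylReach` FROM THE TWO C-I STAGES.**  For ANY predicate `Good` on ideal sheaves:
if (ENGINE) every non-zero «good» ideal on an integral regular excellent Noetherian scheme is principalised by blowings up with regular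
centres over its cosupport with regular top, and (POLE STAGE) on every reachable cylinder state, format-snc on the cylinder region, finitely many blowings up with regular
centres over `cosupp K♭` and regular Noetherian top make the total transform of `K♭` «good» — then Phase C-I reaches the residual END on
every reachable cylinder state.  (`Good K := ∃ 𝓛, ∀ x ∈ cosupp K, IsEndNear K 𝓛 x` is the instance of record, RULING G12-27 (A).)
[cite: Kollar2007, (3.111) Steps 1–3] [cite: GortzWedhorn2020, Prop. 13.91 (1)–(2)] -/
theorem phaseCOne_cylReach_of_stages (Good : ∀ ⦃Y : Scheme.{u}⦄, Y.IdealSheafData → Prop)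
    (hLMG : ∀ (Y : Scheme.{u}) [IsNoetherian Y] [IsIntegral Y], Scheme.IsRegular Y → Scheme.IsExcellent Y →
      ∀ K : Y.IdealSheafData, K ≠ ⊥ → Good K →
      ∃ s : CentreSeq Y, s.AllRegular ∧ s.CentresOver (K.support : Set Y) ∧ Scheme.IsRegular s.top ∧ IsLocallyPrincipal (K.comap s.comp))
    (hCure : ∀ {X : Scheme.{u}} [IsNoetherian X], Scheme.IsRegular X → Scheme.IsExcellent X →
      ∀ (S : MultiHostState X) (cyl : CylState S) [IsIntegral cyl.Z] [IsNoetherian cyl.Z], Scheme.IsRegular cyl.Z → S.n ≠ 0 →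
      ∀ (𝓒 : List X.IdealSheafData) (𝓗 : Fin S.n → List (X.IdealSheafData × ℕ)), S.IsFormatSncOn cyl.V 𝓒 𝓗 → CylReach S cyl →
      ∃ c : CentreSeq X, c.AllRegular ∧ c.CentresOver (S.residual.K.support : Set X) ∧ Scheme.IsRegular c.top ∧
        ∃ _ : IsNoetherian c.top, Good (S.residual.K.comap c.comp)) :
    PhaseCOne CylReach.{u} := by
  intro X _ hX hXe S cyl _ _ hZreg hn 𝓒 𝓗 hfmt hreach
  haveI := hreach.isIntegral
  have hK0 : S.residual.K ≠ ⊥ := hreach.residual_K_ne_bot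
  -- stage 1: the pole cures
  obtain ⟨c, hcreg, hcover, hctop, hcN, hgood⟩ := hCure hX hXe S cyl hZreg hn 𝓒 𝓗 hfmt hreach
  obtain ⟨hcint, hcne⟩ := MultiHostState.centreSeq_isIntegral_top_and_comap_ne_bot c hK0 hcover
  haveI := hcint
  -- stage 2: the locally-monomial game on the (integral, regular, excellent) top of the cures
  obtain ⟨s, hsreg, hsover, hstop, hlp⟩ := hLMG c.top hctop (CentreSeq.isExcellent_top c hXe) _ hcne hgood
  -- one sequence; `K♭𝒪` locally principal and non-zero on the integral top, hence effective Cartier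
  have hsover' : s.CentresOver (c.comp.base ⁻¹' (S.residual.K.support : Set X)) := by
    have h' := hsover
    rwa [Scheme.IdealSheafData.support_comap] at h'
  obtain ⟨hsint, hsne⟩ := MultiHostState.centreSeq_isIntegral_top_and_comap_ne_bot s hcne hsover
  haveI := hsint
  have hE : IsEffectiveCartier (S.residual.K.comap (s.comp ≫ c.comp)) := by
    rw [Scheme.IdealSheafData.comap_comp]; exact hlp.isEffectiveCartier_of_ne_bot hsne
  obtain ⟨t, htreg, htover, httop, htE⟩ :=
    exists_centreSeq_two_stage c S.residual.K _ hcreg hcover s hsreg hsover' hstop hE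
  exact S.phaseCOne_conclusion_of_isEffectiveCartier hn t htreg htover httop htE

end Summit.ResolutionOfSingularities.ResolutionOfSingularities.Theorems.ChainW52F7BetaRP

end
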